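import Literature.Computability.AlgebraicComplexity.BurgisserBooleanParts
import Literature.Computability.Complexity.CircuitEval
import HarnessLib

/-!
# The target fact `PPoly_eq_polyAdvice_NP_of_VP_eq_VNP` from (A3) alone

Trunk T-CPLX-ALG. Proof-only companion of `BurgisserBooleanParts.lean` (Bürgisser, *Cook's versus
Valiant's hypothesis*, TCS 235 (2000)). There the target fact
`Literature.PNP.PPoly_eq_polyAdvice_NP_of_VP_eq_VNP k` (Cor. 1.2(1): under GRH, `VP_k = VNP_k` in
characteristic zero gives `P/poly = NP/poly`) is derived from three inputs: (A2)
`NP_booleanPart_VNP k` (proved there), (A3) `booleanPart_VP_cktSize k` (named fact, TCS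
Thm. 1.1(1), resting on Thm. 4.1 under GRH) and Arora–Barak's Thm. 6.18 `PPoly_eq_polyAdvice_P`.
The latter is discharged in the tree (`Literature.Computability.Complexity.PPoly_eq_polyAdvice_P_holds`,
`CircuitEval.lean`), so the target fact follows from (A3) alone
(`PPoly_eq_polyAdvice_NP_of_VP_eq_VNP_of_booleanPart_VP_cktSize`). This file only imports
`CircuitEval.lean` on top of `BurgisserBooleanParts.lean` and contains no definitions.

## References

* P. Bürgisser, *Cook's versus Valiant's hypothesis*, Theoret. Comput. Sci. 235 (2000) 71–88,
  Thm. 1.1(1) (p. 73), Cor. 1.2(1) (p. 74) and its proof (p. 79).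
* S. Arora, B. Barak, *Computational Complexity: A Modern Approach*, CUP 2009, Thm. 6.18.
-/

noncomputable section

open Literature.Computability.Complexity Literature.Computability.Complexity.Classes Literature.Computability.Complexity.Nondeterministic Literature.Computability.AlgebraicComplexity

namespace Literature.Computability.AlgebraicComplexity

universe u

variable {k : Type u} [Field k]

/-- **The target fact from (A3) alone**: `PPoly_eq_polyAdvice_NP_of_VP_eq_VNP k` (Bürgisser 2000
TCS, Cor. 1.2(1); book Cor. 4.6(1)) follows from the named fact `booleanPart_VP_cktSize k`
(TCS Thm. 1.1(1)), the inclusion `#P ⊆ BP(VNP_k)` (`NP_booleanPart_VNP_holds`) and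
`P/poly = P/poly-advice` (`PPoly_eq_polyAdvice_P_holds`) being proved in the tree.
[cite: Burgisser2000TCS, Cor. 1.2(1) p. 74] [cite: Burgisser2000, Cor. 4.6(1)] -/
theorem PPoly_eq_polyAdvice_NP_of_VP_eq_VNP_of_booleanPart_VP_cktSize
    (hA3 : booleanPart_VP_cktSize k) : PPoly_eq_polyAdvice_NP_of_VP_eq_VNP k :=
  PPoly_eq_polyAdvice_NP_of_VP_eq_VNP_of_A3 PPoly_eq_polyAdvice_P_holds hA3

/-- Likewise the first conjunct `polyAdvice P = polyAdvice NP` of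
`burgisser_collapse_of_VP_eq_VNP_charZero k` from (A3) alone (Bürgisser 2000 TCS, Cor. 1.2(1)).
[cite: Burgisser2000TCS, Cor. 1.2(1) p. 74] -/
theorem polyAdvice_P_eq_polyAdvice_NP_of_VP_eq_VNP_of_booleanPart_VP_cktSize
    (hA3 : booleanPart_VP_cktSize k) [CharZero k] (hGRH : Literature.NumberTheory.LFunctions.ExtendedRiemannHypothesis)
    (h : VP k = VNP k) : polyAdvice P = polyAdvice NP :=
  polyAdvice_P_eq_polyAdvice_NP_of_VP_eq_VNP_of_A3 PPoly_eq_polyAdvice_P_holds hA3 hGRH h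

end Literature.Computability.AlgebraicComplexity
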